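import Mathlib
import HarnessLib
import Summits.Langlands.Langlands.Theses.NonParallelVoid
import Literature.NumberTheory.GaloisRepresentations.ModNCyclotomicCharacter

/-!
# Birth skeleton (BC3) for crux stmt-Langlands-17008
`Summit.Langlands.Langlands.Theses.NonParallelVoid.EmptyWeightCore` — line `birth`
("determinant parity empties the core")

Route `route-Langlands-NonParallelVoid` (crux #2, rank 2, "THE HARD CORE").  The crux: for `F`
imaginary quadratic, `p ≥ 11` SPLIT in `F`, `ρ : Γ_F → GL₂(ℚ̄_p)` irreducible, a.e. unramified,
CRYSTALLINE at both `v ∣ p` with labelled Hodge–Tate weights `{a_v, b_v}`, `a_v < b_v` (pinned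
Fontaine datum), not nearly ordinary at every `v ∣ p`, `ρ̄|Γ_{F(ζ_p)}` absolutely irreducible, gap sum
`(b_v - a_v) + (b_w - a_w)` ODD for some pair of labels, and `ρ̄` of BASE-CHANGE TYPE (trace/det form:
`tr ρ̄(θ_τ σ) = χ̄(σ) tr ρ̄(σ)`, `det ρ̄(θ_τ σ) = χ̄(σ)² det ρ̄(σ)` for some `τ ∈ Γ_ℚ ∖ res Γ_F` and a
character `χ̄`) ⇒ all gaps are equal (`∃ g, HT = {a, a + g}` at every label).

## The line: the regime of the crux is EMPTY, by a determinant-parity computation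

Under "odd gap sum" the conclusion "all gaps equal" is itself contradictory, so the crux says exactly
that its hypotheses are inconsistent; and they are, for an elementary reason that uses only the
DETERMINANT clause of base-change type and crystallinity at the two places above the odd split
prime `p = v w` (`F_v = F_w = ℚ_p`):

* (p-adic Hodge theory of the determinant, `stub_crystallineDetInertia`)  `det ρ|Γ_{F_v}` is a
  crystalline character of `Γ_{ℚ_p}` with Hodge–Tate weight `a_v + b_v`, hence equals
  `ε^{-(a_v+b_v)}` times an UNRAMIFIED character (tree convention `HT(ε) = -1`, clause (F11) of the
  pinned datum: `HT(ε^m) = {-m}`); reducing, `det ρ̄ = ω̄^{-(a_v+b_v)}` on every inertia group of `Γ_F`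
  above `v` (`ω̄` = the mod-`p` cyclotomic character `modNCyclotomicCharacter F p`, read in the residue
  field `k = ℤ̄_p/𝔪` of `ℚ̄_p` through `ZMod.cast`).
* (Galois bookkeeping of base-change type, `stub_baseChangeDetParity`)  if `det ρ̄ ∘ θ_τ = χ̄² · det ρ̄`
  (with the trace relation, which makes `χ̄` continuous: `χ̄ = 1` on `ker ρ̄ ∩ θ_τ⁻¹ ker ρ̄` as `2 ≠ 0`
  in `k`), and `det ρ̄|I = ω̄^{e_v}` above `v`, `= ω̄^{e_w}` above `w`, then `e_v ≡ e_w (mod 2)`: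
  `θ_τ` carries the inertia groups above `w` onto those above `v = τ(w)` (`τ|_F = c` swaps the two
  places), `ω̄ ∘ θ_τ = ω̄`, a continuous character of `Γ_{ℚ_p}` is a power `ω̄^j` on inertia, and
  `ω̄` maps inertia above the unramified `p` ONTO `𝔽_pˣ` (cyclic of EVEN order `p - 1`), so
  `ω̄^{e_v} = ω̄^{2j} ω̄^{e_w}` on inertia forces `p - 1 ∣ e_v - 2j - e_w`, i.e. `2 ∣ e_v - e_w`
  (for `v = w` the same surjectivity gives `p - 1 ∣ e_v - e_w` directly).
* (the seam, `EmptyWeightCore_of`, kernel-checked)  with `e_v = -(a_v + b_v)`, `e_w = -(a_w + b_w)`: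
  `a_v + b_v ≡ a_w + b_w`, so `(b_v - a_v) + (b_w - a_w) ≡ (a_v + b_v) + (a_w + b_w) ≡ 0 (mod 2)` for
  EVERY pair of labels — the negated hypothesis `¬ (∀ …, Even (b - a + (b' - a')))` of the crux is
  refuted, and the crux follows (`(hnE _).elim`).

So the crux closes OUTRIGHT (no patching, no torsion, no Fontaine–Laffaille range), modulo the two
stubs: `stub_baseChangeDetParity` is unconditional Galois/cyclotomic bookkeeping over tree
constructions (size M–L); `stub_crystallineDetInertia` is a theorem of `p`-adic Hodge theory for
Fontaine's genuine datum (Fontaine Exp. VIII §2.3.7; Brinon–Conrad Prop. 8.3.4, §9.3: crystalline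
characters of `Γ_{ℚ_p}` are unramified twists of `ε^m`; `∧²` of crystalline is crystalline with the
sum weight) which, for the datum pinned BY SPECIFICATION (`Literature.NumberTheory.PAdicHodge.FontaineDpst`,
Weil–Deligne half (F4)/(F8)), needs one clause addition along that file's "Upgrade path"
(determinant compatibility of `D_pst`, or directly "𝔇-crystalline rank-one representations of
`Γ_{ℚ_p}` are `unr · ε^m` with `HT = {-m}`") — recorded on the line card as the named gap.

CONSEQUENCE FOR THE ROUTE (for the tenure planner; this seat files no items): the "odd gap sum ∧
base-change type" sector of the `closes` case split is void for parity reasons, NOT for the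
torsion-patching reasons the route header gives; the residually base-change-type non-parallel `ρ`
(the feared hard core) all have EVEN gap sum and sit inside `TwistedInductionParallel` (#3), where
`2(b - a) = gap difference` is solvable.  `EmptyWeightCore` is therefore a cheap crux once
`stub_crystallineDetInertia`'s clause lands; its rank-2 / open-problem labels are misplaced.

Idea realised: crux idea `det-parity-empties-core` (evidence on stmt-Langlands-17008 by
planner-idea-node-Langlands-g15-0, 2026-08-17T00:15Z: "base-change-type residue (det clause) +
crystalline at the two places above an odd split p force (b-a)+(b'-a') EVEN; crux provable outright
modulo two pinned-datum clauses (C-det, C-char)"; its card/Sketch are gate-side evidence not readable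
from this hub — this skeleton was derived independently and agrees with that summary; C-det ↔
`stub_crystallineDetInertia`, C-char is folded into `stub_baseChangeDetParity`).

Disproof used: none on file (`ledger crux ls stmt-Langlands-17008`: no workfiles, no `Disproof.lean`,
no `Negative/` lemmas, 2026-08-17).  Dead lines: none recorded for this crux.  Negatives index
(`ledger negatives --problem Langlands`): no statement about determinants / parity / base-change type.

Shape (for `ledger skeleton check`): two stubs `theorem stub_<name> : <signature> := by sorry` written
out over tree declarations only (`FramedGaloisRep`, `FramedGaloisRep.residualRep`, `toLocal`,
`labelledHodgeTateWeightsAt`, `PAdicHodge.fontainePstAdicCompletion`, `PstWeilDeligneData.IsCrystallineFramed`,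
`absGaloisRestrict`, `modNCyclotomicCharacter`, `padicAlgClResidueField`, `HeightOneSpectrum.primesAbove`,
Mathlib `AddSubgroup.inertia`, `ZMod.cast`); `_Goal.stub_<name> : Prop := type_of% @stub_<name>` names
each statement; `EmptyWeightCore_of (h₁ : _Goal.stub_crystallineDetInertia)
(h₂ : _Goal.stub_baseChangeDetParity) : EmptyWeightCore` is proved without `sorry` and concludes the
route decl BY NAME.
-/

set_option linter.dupNamespace false
set_option linter.unusedVariables false

noncomputable section

namespace Summit.Langlands.Langlands.Cruxes.EmptyWeightCore.Birth

open Summit.Langlands.Langlands.Theses.NonParallelVoid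

/-! ## 1. The two stubs -/

/-- **STUB 1 — the determinant of a crystalline plane on inertia, residually**
(`p`-adic Hodge theory of `det`).  Let `F` be a quadratic field in which `p` splits (two distinct
places above `p`, so `F_v = ℚ_p` for `v ∣ p`) and `ρ : Γ_F → GL₂(ℚ̄_p)` crystalline at every `v ∣ p`
for the pinned Fontaine datum.  If the (unique) label `τ` at `v ∣ p` has `HT_τ(ρ|Γ_{F_v}) = {a, b}`,
then on every inertia subgroup `I_𝔓 ≤ Γ_F`, `𝔓` a prime of `\bar ℤ_F` above `v`, the determinant of
the residual representation is the `-(a+b)`-th power of the mod-`p` cyclotomic character: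
`det ρ̄(σ) = ω̄(σ)^{-(a+b)}` in `k = ℤ̄_p/𝔪` (`ω̄ = modNCyclotomicCharacter F p` read in `k` via
`ZMod.cast`).  Informal proof: `det ρ|Γ_{F_v} = ∧² ρ|Γ_{F_v}` is crystalline with the single
Hodge–Tate weight `a + b`; crystalline characters of `Γ_{ℚ_p}` are `unr · ε^m` and `HT(ε^m) = {-m}`
(tree convention, clause (F11) of the pin), so `det ρ|I_v = ε^{-(a+b)}`; the residual representation
has the reduced characteristic polynomials (`HasResidualCharpolys`), so `det ρ̄ = det ρ mod 𝔪`, and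
`ε mod 𝔪 = ω̄`.  Size L: the `∧²`/rank-one crystalline input is a clause addition for the pinned
datum (Upgrade path of `FontaineDpst`); the rest is in-tree bookkeeping.
[cite: FontaineAsterisque223VIII, §2.3.7] [cite: BrinonConrad2009, Prop. 8.3.4 and §9.3]
[cite: BarnetlambEtAl2014, Introduction (Notation: HT_τ(ε_l) = {-1})] -/
theorem stub_crystallineDetInertia :
    ∀ (F : Type) [Field F] [NumberField F] [Algebra.IsQuadraticExtension ℚ F] (p : ℕ) [Fact p.Prime]
      (ρ : Literature.NumberTheory.GaloisRepresentations.FramedGaloisRep F (PadicAlgCl p) 2),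
      (∃ v w : IsDedekindDomain.HeightOneSpectrum (NumberField.RingOfIntegers F), v ≠ w ∧
          ((p : ℕ) : NumberField.RingOfIntegers F) ∈ v.asIdeal ∧
          ((p : ℕ) : NumberField.RingOfIntegers F) ∈ w.asIdeal) →
      (∀ (v : IsDedekindDomain.HeightOneSpectrum (NumberField.RingOfIntegers F))
          (hv : ((p : ℕ) : NumberField.RingOfIntegers F) ∈ v.asIdeal),
          (Literature.NumberTheory.PAdicHodge.fontainePstAdicCompletion v p hv).IsCrystallineFramed
            (ρ.toLocal v)) →
      ∀ (v : IsDedekindDomain.HeightOneSpectrum (NumberField.RingOfIntegers F))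
        (hv : ((p : ℕ) : NumberField.RingOfIntegers F) ∈ v.asIdeal),
        letI := (Literature.NumberTheory.PAdicHodge.fontainePstAdicCompletion v p hv).algebra
        ∀ (τ : v.adicCompletion F →ₐ[ℚ_[p]] PadicAlgCl p) (a b : ℤ),
          ρ.labelledHodgeTateWeightsAt v
              (Literature.NumberTheory.PAdicHodge.fontainePstAdicCompletion v p hv).algebra
              (Literature.NumberTheory.PAdicHodge.fontainePstAdicCompletion v p hv).𝔅 τ.toRingHom =
            {a, b} →
          ∀ 𝔓 ∈ v.primesAbove, ∀ σ ∈ 𝔓.inertia (Field.absoluteGaloisGroup F),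
            (ρ.residualRep σ).val.det =
              (ZMod.cast
                  ((Literature.NumberTheory.GaloisRepresentations.modNCyclotomicCharacter F p σ :
                      (ZMod p)ˣ) : ZMod p) :
                Literature.NumberTheory.GaloisRepresentations.padicAlgClResidueField p) ^ (-(a + b)) := by
  sorry

/-- **STUB 2 — base-change type preserves the PARITY of the inertial determinant exponent across the
places above `p`** (Galois / cyclotomic bookkeeping; no `p`-adic Hodge theory, no pinned datum).
Let `F` be a quadratic field, `p > 2` a prime with two distinct places above it, `ρ : Γ_F → GL₂(ℚ̄_p)`,
and suppose `ρ̄ = ρ.residualRep` is of base-change type in the crux's trace/det form (some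
`τ ∈ Γ_ℚ ∖ res Γ_F` and `χ̄ : Γ_F →* kˣ` with `tr ρ̄(σ') = χ̄(σ) tr ρ̄(σ)` and
`det ρ̄(σ') = χ̄(σ)² det ρ̄(σ)` whenever `res σ' = τ (res σ) τ⁻¹`).  If `det ρ̄ = ω̄^e` on every inertia
group above `v ∣ p` and `det ρ̄ = ω̄^{e'}` on every inertia group above `w ∣ p`, then `e ≡ e' (mod 2)`.
Informal proof: `res Γ_F ⊴ Γ_ℚ` (`F/ℚ` normal), so `θ_τ σ` exists for every `σ` and is continuous in
`σ`; `ρ̄` has open kernel (reduction of a continuous `ρ`; junk value `1` otherwise), hence `χ̄ = 1` on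
the open subgroup `ker ρ̄ ∩ θ_τ⁻¹(ker ρ̄)` (trace relation, `2 ≠ 0` in `k` as `p > 2`) and `χ̄` is
continuous; a continuous `kˣ`-valued character of a decomposition group at `w` (`≅ Γ_{ℚ_p}`) is `ω̄^j`
on inertia (level-one tame characters); `θ_τ` maps the inertia groups above `w` onto inertia groups
above `τ(w) = v` when `v ≠ w` (`τ|_F` is the nontrivial automorphism, transitive on the two places),
and `ω̄ ∘ θ_τ = ω̄`; finally `ω̄` maps every inertia group above the unramified `p` ONTO `𝔽_pˣ`, cyclic
of even order `p - 1`, and `ZMod.cast : 𝔽_p → k` is injective: `ω̄^e = ω̄^{2j} ω̄^{e'}` on inertia gives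
`p - 1 ∣ e - 2j - e'`, and for `v = w` directly `p - 1 ∣ e - e'`.  Size M–L.
[cite: SerreLocalFields1979, Ch. IV §2 (inertia under conjugation)] [cite: NeukirchANT1999, Ch. II §9 Prop. (9.6)]
[cite: Serre1972, §1.7 (characters of tame inertia of level 1)] [cite: Washington1997, Ch. 2 (χ_p onto, ℚ_p(ζ_p)/ℚ_p totally ramified)] -/
theorem stub_baseChangeDetParity :
    ∀ (F : Type) [Field F] [NumberField F] [Algebra.IsQuadraticExtension ℚ F] (p : ℕ) [Fact p.Prime],
      2 < p →
      (∃ v w : IsDedekindDomain.HeightOneSpectrum (NumberField.RingOfIntegers F), v ≠ w ∧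
          ((p : ℕ) : NumberField.RingOfIntegers F) ∈ v.asIdeal ∧
          ((p : ℕ) : NumberField.RingOfIntegers F) ∈ w.asIdeal) →
      ∀ (ρ : Literature.NumberTheory.GaloisRepresentations.FramedGaloisRep F (PadicAlgCl p) 2),
      (∃ τ : Field.absoluteGaloisGroup ℚ,
          τ ∉ Set.range (Literature.NumberTheory.GaloisRepresentations.absGaloisRestrict ℚ F) ∧
          ∃ χ : Field.absoluteGaloisGroup F →*
              (Literature.NumberTheory.GaloisRepresentations.padicAlgClResidueField p)ˣ,
            ∀ σ σ' : Field.absoluteGaloisGroup F,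
              Literature.NumberTheory.GaloisRepresentations.absGaloisRestrict ℚ F σ' =
                  τ * Literature.NumberTheory.GaloisRepresentations.absGaloisRestrict ℚ F σ * τ⁻¹ →
                (ρ.residualRep σ').val.trace =
                    (χ σ : Literature.NumberTheory.GaloisRepresentations.padicAlgClResidueField p) *
                      (ρ.residualRep σ).val.trace ∧
                  (ρ.residualRep σ').val.det =
                    (χ σ : Literature.NumberTheory.GaloisRepresentations.padicAlgClResidueField p) ^ 2 *
                      (ρ.residualRep σ).val.det) →
      ∀ (v w : IsDedekindDomain.HeightOneSpectrum (NumberField.RingOfIntegers F)),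
        ((p : ℕ) : NumberField.RingOfIntegers F) ∈ v.asIdeal →
        ((p : ℕ) : NumberField.RingOfIntegers F) ∈ w.asIdeal →
        ∀ (e e' : ℤ),
          (∀ 𝔓 ∈ v.primesAbove, ∀ σ ∈ 𝔓.inertia (Field.absoluteGaloisGroup F),
            (ρ.residualRep σ).val.det =
              (ZMod.cast
                  ((Literature.NumberTheory.GaloisRepresentations.modNCyclotomicCharacter F p σ :
                      (ZMod p)ˣ) : ZMod p) :
                Literature.NumberTheory.GaloisRepresentations.padicAlgClResidueField p) ^ e) →
          (∀ 𝔓 ∈ w.primesAbove, ∀ σ ∈ 𝔓.inertia (Field.absoluteGaloisGroup F),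
            (ρ.residualRep σ).val.det =
              (ZMod.cast
                  ((Literature.NumberTheory.GaloisRepresentations.modNCyclotomicCharacter F p σ :
                      (ZMod p)ˣ) : ZMod p) :
                Literature.NumberTheory.GaloisRepresentations.padicAlgClResidueField p) ^ e') →
          Even (e - e') := by
  sorry

/-! ## 2. The stub statements as named `Prop`s (literally their types) -/

namespace _Goal

/-- The statement of `stub_crystallineDetInertia`, as a named `Prop` (literally its type). [folklore] -/
def stub_crystallineDetInertia : Prop :=
  type_of% @Summit.Langlands.Langlands.Cruxes.EmptyWeightCore.Birth.stub_crystallineDetInertia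

/-- The statement of `stub_baseChangeDetParity`, as a named `Prop` (literally its type). [folklore] -/
def stub_baseChangeDetParity : Prop :=
  type_of% @Summit.Langlands.Langlands.Cruxes.EmptyWeightCore.Birth.stub_baseChangeDetParity

end _Goal

/-! ## 3. The arithmetic seam (proved) -/

/-- If `-(a + b) ≡ -(a' + b') (mod 2)` then the gap sum `(b - a) + (b' - a')` is even:
`(b - a) + (b' - a') = ((a' + b') - (a + b)) + 2 (b - a')`. [folklore] -/
theorem gapSum_even_of_detExponents_even {a b a' b' : ℤ} (h : Even (-(a + b) - -(a' + b'))) :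
    Even (b - a + (b' - a')) := by
  obtain ⟨r, hr⟩ := h
  exact ⟨r + b - a', by omega⟩

/-! ## 4. The composition (kernel-checked, no `sorry`): DET ON INERTIA → PARITY TRANSPORT → the crux by name -/

/-- **`EmptyWeightCore` from the two stubs.**  Fix the data of the crux and argue by refuting its
negated hypothesis `¬ (∀ v w τ σ a b a' b', HT_{v,τ} = {a,b} → a < b → HT_{w,σ} = {a',b'} → a' < b' →
Even (b - a + (b' - a')))`: for any two labels, `stub_crystallineDetInertia` (fed the split and
crystalline clauses of the good-regime hypothesis) gives `det ρ̄ = ω̄^{-(a+b)}` on inertia above `v` and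
`det ρ̄ = ω̄^{-(a'+b')}` on inertia above `w`; `stub_baseChangeDetParity` (fed `2 < p` from `11 ≤ p`,
the split clause and the base-change-type hypothesis verbatim) gives `-(a+b) ≡ -(a'+b') (mod 2)`;
`gapSum_even_of_detExponents_even` turns that into `Even (b - a + (b' - a'))`.  The hypotheses are, by
name, the statements of the two stubs; the conclusion is the route decl
`Summit.Langlands.Langlands.Theses.NonParallelVoid.EmptyWeightCore`. [folklore] -/
theorem EmptyWeightCore_of (h₁ : _Goal.stub_crystallineDetInertia)
    (h₂ : _Goal.stub_baseChangeDetParity) :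
    Summit.Langlands.Langlands.Theses.NonParallelVoid.EmptyWeightCore := by
  -- the stub statements, as the Π-types they literally are
  have hDet : type_of% @stub_crystallineDetInertia := h₁
  have hPar : type_of% @stub_baseChangeDetParity := h₂
  intro F _ _ _ hF p _ ρ hirr hunr hHT hLR hG hnE hBC
  -- the good regime: `11 ≤ p`, `p` split (two places), crystalline at every `v ∣ p`, `ρ̄|F(ζ_p)` abs. irreducible
  obtain ⟨hp11, hsplit, hcrys, _hresirr⟩ := hG
  -- the crux's conclusion is reached by refuting the "odd gap sum" hypothesis
  refine (hnE ?_).elim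
  intro v hv w hw τ σ a b a' b' hab hlt hab' hlt'
  -- `det ρ̄ = ω̄^{-(a+b)}` on inertia above `v`, `det ρ̄ = ω̄^{-(a'+b')}` on inertia above `w`
  have hv' := hDet F p ρ hsplit hcrys v hv τ a b hab
  have hw' := hDet F p ρ hsplit hcrys w hw σ a' b' hab'
  -- base-change type transports the exponent between the two places up to an even shift
  have hpar : Even (-(a + b) - -(a' + b')) :=
    hPar F p (by omega) hsplit ρ hBC v w hv hw (-(a + b)) (-(a' + b')) hv' hw'
  exact gapSum_even_of_detExponents_even hpar

/-- By-name sanity check (an `example`, not a declaration of the file): the two stubs feed the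
composition as they stand. -/
example : Summit.Langlands.Langlands.Theses.NonParallelVoid.EmptyWeightCore :=
  EmptyWeightCore_of stub_crystallineDetInertia stub_baseChangeDetParity

end Summit.Langlands.Langlands.Cruxes.EmptyWeightCore.Birth

end
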